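import Summits.QuantumFields.YangMills.Theorems.BalabanLadderIRLightCodeDefs
import Summits.QuantumFields.YangMills.Theorems.PencilRigidityWeakCouplingHypercubicLimitStubTraceCluster
import HarnessLib

/-!
# Route `BalabanLadder`, crux `IR` (stmt-QuantumFields-19354): flux-code blindness — the `CodeTrace` engine, part 1

Finite-dimensional linear algebra behind the `q`-level trace clustering `stub_codeTraceCluster`
(`BalabanLadderIRLightCodeTraceCluster`): the frame projection `P = Σ |e_k⟩⟨e_k|` and the weighted frame operators
`P_m = Σ θ_k^m |e_k⟩⟨e_k|` of an orthonormal light frame, the residual `R_m = T^m − P_m` of a positive operator `T` with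
the frame as eigenvectors and contraction `ρ` off the frame (`R_m` is POSITIVE with `‖R_m‖ ≤ ρ^m`), and the trace
identities `tr (P_m M) = Σ θ_k^m ⟨e_k, M e_k⟩`, `tr P_m = Σ θ_k^m`, the `LL` double sum.  Source: crux-idea card
`Cruxes/IR/Ideas/ym19354-5-flux-code-blindness.md` (seat `ym-cruxidea-19354-5` gen 3, `Sketch-g3.lean` rev 3 sha16
`c463f541daed4b01`, sub-namespace `CodeTrace`), landed per route-owner ruling R34 (ym-beyond-p2 g25) `--supports
stmt-QuantumFields-19354`; the `q = 0` twin is the landed `Theorems/PencilRigidityWeakCouplingHypercubicLimitStubTraceCluster.lean`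
(whose `trace_rankOne_mul_eq` ∕ `abs_real_inner_apply_le_opNorm` are reused).  All statements are [folklore] linear algebra
over Mathlib (`rankOne`, `Orthonormal`, `ContinuousLinearMap.IsPositive`, `LinearMap.trace`).  Nothing here is
summit-bearing by itself; not a gap claim.
-/

set_option autoImplicit false

noncomputable section

open scoped BigOperators InnerProductSpace
open InnerProductSpace
open Summit.QuantumFields.YangMills.Theorems.WeakCouplingHypercubicLimit.TraceNormColdPressure (trace_rankOne_mul_eq)

namespace Summit.QuantumFields.YangMills.Cruxes.IR.FluxCodeBlindness.CodeTrace

/-! ## Frame projection and weighted frame operators -/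

section Frame

variable {E : Type*} [NormedAddCommGroup E] [InnerProductSpace ℝ E] {q : ℕ}

/-- `P v = Σ_k ⟨e_k, v⟩ e_k`. -/
theorem frameProj_apply (e : Fin (q + 1) → E) (v : E) :
    frameProj e v = ∑ k, ⟪e k, v⟫_ℝ • e k := by
  simp [frameProj, rankOne_apply]

/-- `P_m v = Σ_k θ_k^m ⟨e_k, v⟩ e_k`. -/
theorem framePow_apply (e : Fin (q + 1) → E) (θ : Fin (q + 1) → ℝ) (m : ℕ) (v : E) :
    framePow e θ m v = ∑ k, (θ k ^ m * ⟪e k, v⟫_ℝ) • e k := by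
  simp [framePow, rankOne_apply, smul_smul]

/-- The range of `P` is orthogonal to every vector orthogonal to the frame. -/
theorem inner_frameProj_left_of_perp (e : Fin (q + 1) → E) {u : E} (hu : ∀ k, ⟪e k, u⟫_ℝ = 0) (v : E) :
    ⟪frameProj e v, u⟫_ℝ = 0 := by
  rw [frameProj_apply, sum_inner]
  simp [real_inner_smul_left, hu]

variable {e : Fin (q + 1) → E}

/-- For an orthonormal frame, `⟨e_k, P v⟩ = ⟨e_k, v⟩`. -/
theorem inner_frameProj (hon : Orthonormal ℝ e) (k : Fin (q + 1)) (v : E) :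
    ⟪e k, frameProj e v⟫_ℝ = ⟪e k, v⟫_ℝ := by
  rw [frameProj_apply]; exact hon.inner_right_fintype _ k

/-- For an orthonormal frame, `⟨e_k, P_m v⟩ = θ_k^m ⟨e_k, v⟩`. -/
theorem inner_framePow (hon : Orthonormal ℝ e) (θ : Fin (q + 1) → ℝ) (m : ℕ) (k : Fin (q + 1)) (v : E) :
    ⟪e k, framePow e θ m v⟫_ℝ = θ k ^ m * ⟪e k, v⟫_ℝ := by
  rw [framePow_apply]; exact hon.inner_right_fintype _ k

/-- `v − P v` is orthogonal to the frame. -/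
theorem inner_sub_frameProj (hon : Orthonormal ℝ e) (v : E) (k : Fin (q + 1)) :
    ⟪e k, v - frameProj e v⟫_ℝ = 0 := by
  rw [inner_sub_right, inner_frameProj hon, sub_self]

/-- Bessel: `‖v − P v‖ ≤ ‖v‖`. -/
theorem norm_sub_frameProj_le (hon : Orthonormal ℝ e) (v : E) : ‖v - frameProj e v‖ ≤ ‖v‖ := by
  have hperp : ⟪frameProj e v, v - frameProj e v⟫_ℝ = 0 :=
    inner_frameProj_left_of_perp e (fun k => inner_sub_frameProj hon v k) v
  have h := norm_add_sq_real (frameProj e v) (v - frameProj e v)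
  rw [show frameProj e v + (v - frameProj e v) = v by abel, hperp] at h
  have h2 : ‖v - frameProj e v‖ ^ 2 ≤ ‖v‖ ^ 2 := by
    rw [h]; nlinarith [sq_nonneg ‖frameProj e v‖]
  exact (sq_le_sq₀ (norm_nonneg _) (norm_nonneg _)).1 h2

end Frame

/-! ## The residual `R_m = T^m − P_m`: contraction off the frame -/

section Transfer

variable {E : Type*} [NormedAddCommGroup E] [InnerProductSpace ℝ E] {q : ℕ}
  {T : E →L[ℝ] E} {e : Fin (q + 1) → E} {θ : Fin (q + 1) → ℝ} {ρ : ℝ}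

/-- Frame vectors are eigenvectors of every power: `T^m e_k = θ_k^m e_k`. -/
theorem pow_apply_frame (hTe : ∀ k, T (e k) = θ k • e k) (m : ℕ) (k : Fin (q + 1)) :
    (T ^ m) (e k) = θ k ^ m • e k := by
  induction m with
  | zero => simp
  | succ m ih =>
    rw [pow_succ, mul_apply_eq_comp, hTe, map_smul, ih, smul_smul]
    congr 1; ring

/-- A positive (hence symmetric) `T` with the frame as eigenvectors preserves the orthocomplement of the frame. -/
theorem inner_frame_apply_of_perp (hT : T.IsPositive) (hTe : ∀ k, T (e k) = θ k • e k) {u : E}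
    (hu : ∀ k, ⟪e k, u⟫_ℝ = 0) (k : Fin (q + 1)) : ⟪e k, T u⟫_ℝ = 0 := by
  rw [← hT.inner_left_eq_inner_right, hTe, real_inner_smul_left, hu, mul_zero]

/-- Off the frame the powers contract: `‖T^m u‖ ≤ ρ^m ‖u‖` and `T^m u` stays orthogonal to the frame. -/
theorem pow_apply_perp (hT : T.IsPositive) (hTe : ∀ k, T (e k) = θ k • e k) (hρ : 0 ≤ ρ)
    (hcon : ∀ v, (∀ k, ⟪e k, v⟫_ℝ = 0) → ‖T v‖ ≤ ρ * ‖v‖) (m : ℕ) {u : E}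
    (hu : ∀ k, ⟪e k, u⟫_ℝ = 0) :
    ‖(T ^ m) u‖ ≤ ρ ^ m * ‖u‖ ∧ ∀ k, ⟪e k, (T ^ m) u⟫_ℝ = 0 := by
  induction m with
  | zero => simp [hu]
  | succ m ih =>
    obtain ⟨ihn, ihp⟩ := ih
    rw [pow_succ', mul_apply_eq_comp]
    refine ⟨?_, fun k => inner_frame_apply_of_perp hT hTe ihp k⟩
    calc ‖T ((T ^ m) u)‖ ≤ ρ * ‖(T ^ m) u‖ := hcon _ ihp
      _ ≤ ρ * (ρ ^ m * ‖u‖) := by gcongr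
      _ = ρ ^ (m + 1) * ‖u‖ := by ring

/-- `T^m P = P_m`. -/
theorem pow_mul_frameProj (hTe : ∀ k, T (e k) = θ k • e k) (m : ℕ) :
    T ^ m * frameProj e = framePow e θ m := by
  ext v
  rw [mul_apply_eq_comp, frameProj_apply, framePow_apply, map_sum]
  refine Finset.sum_congr rfl fun k _ => ?_
  rw [map_smul, pow_apply_frame hTe, smul_smul, mul_comm]

/-- The decomposition `T^m = P_m + R_m`. -/
theorem pow_eq_framePow_add_resid (m : ℕ) : T ^ m = framePow e θ m + resid T e θ m := by
  rw [resid]; abel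

/-- `R_m v = T^m (v − P v)`. -/
theorem resid_apply (hTe : ∀ k, T (e k) = θ k • e k) (m : ℕ) (v : E) :
    resid T e θ m v = (T ^ m) (v - frameProj e v) := by
  rw [resid, sub_apply, map_sub, ← mul_apply_eq_comp (T ^ m), pow_mul_frameProj hTe]

/-- The residual contracts: `‖R_m‖ ≤ ρ^m`. -/
theorem norm_resid_le (hon : Orthonormal ℝ e) (hT : T.IsPositive) (hTe : ∀ k, T (e k) = θ k • e k)
    (hρ : 0 ≤ ρ) (hcon : ∀ v, (∀ k, ⟪e k, v⟫_ℝ = 0) → ‖T v‖ ≤ ρ * ‖v‖) (m : ℕ) :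
    ‖resid T e θ m‖ ≤ ρ ^ m := by
  refine ContinuousLinearMap.opNorm_le_bound _ (pow_nonneg hρ m) fun v => ?_
  rw [resid_apply hTe]
  calc ‖(T ^ m) (v - frameProj e v)‖ ≤ ρ ^ m * ‖v - frameProj e v‖ :=
        (pow_apply_perp hT hTe hρ hcon m (inner_sub_frameProj hon v)).1
    _ ≤ ρ ^ m * ‖v‖ := by gcongr; exact norm_sub_frameProj_le hon v

end Transfer

/-! ## The residual is positive (adjoints: complete spaces) -/

section Positive

variable {E : Type*} [NormedAddCommGroup E] [InnerProductSpace ℝ E] [CompleteSpace E] {q : ℕ}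
  {T : E →L[ℝ] E} {e : Fin (q + 1) → E} {θ : Fin (q + 1) → ℝ} {ρ : ℝ}

/-- Powers of a positive operator are positive. [folklore] -/
theorem isPositive_pow' (hT : T.IsPositive) (m : ℕ) : (T ^ m).IsPositive := by
  induction m using Nat.twoStepInduction with
  | zero => rw [pow_zero]; exact ContinuousLinearMap.isPositive_one
  | one => rwa [pow_one]
  | more m ih _ =>
    have h := ih.adjoint_conj T
    rw [hT.isSelfAdjoint.adjoint_eq] at h
    have e : T ^ (m + 2) = T ∘L (T ^ m) ∘L T := by
      rw [pow_succ, pow_succ', ← ContinuousLinearMap.mul_def, ← ContinuousLinearMap.mul_def, mul_assoc]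
    rwa [e]

/-- The weighted frame operators are self-adjoint. -/
theorem isSelfAdjoint_framePow (hon : Orthonormal ℝ e) (θ : Fin (q + 1) → ℝ) (m : ℕ) :
    IsSelfAdjoint (framePow e θ m) := by
  unfold framePow
  refine isSelfAdjoint_sum _ fun k _ => ?_
  exact IsSelfAdjoint.smul (IsSelfAdjoint.all _)
    (isStarProjection_rankOne_self (𝕜 := ℝ) (hon.1 k)).isSelfAdjoint

/-- The residual `R_m = T^m − P_m` is a positive operator (`⟨R_m x, x⟩ = ⟨T^m (x − Px), x − Px⟩ ≥ 0`). -/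
theorem resid_isPositive (hon : Orthonormal ℝ e) (hT : T.IsPositive) (hTe : ∀ k, T (e k) = θ k • e k)
    (hρ : 0 ≤ ρ) (hcon : ∀ v, (∀ k, ⟪e k, v⟫_ℝ = 0) → ‖T v‖ ≤ ρ * ‖v‖) (m : ℕ) :
    (resid T e θ m).IsPositive := by
  rw [ContinuousLinearMap.isPositive_iff']
  refine ⟨(isPositive_pow' hT m).isSelfAdjoint.sub (isSelfAdjoint_framePow hon θ m), fun x => ?_⟩
  have hu : ∀ k, ⟪e k, x - frameProj e x⟫_ℝ = 0 := inner_sub_frameProj hon x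
  have hperp : ∀ k, ⟪e k, (T ^ m) (x - frameProj e x)⟫_ℝ = 0 := (pow_apply_perp hT hTe hρ hcon m hu).2
  have hsplit : ⟪(T ^ m) (x - frameProj e x), x⟫_ℝ =
      ⟪(T ^ m) (x - frameProj e x), frameProj e x⟫_ℝ + ⟪(T ^ m) (x - frameProj e x), x - frameProj e x⟫_ℝ := by
    rw [← inner_add_right, add_sub_cancel]
  have h0 : ⟪(T ^ m) (x - frameProj e x), frameProj e x⟫_ℝ = 0 := by
    rw [real_inner_comm]; exact inner_frameProj_left_of_perp e hperp x
  rw [resid_apply hTe, hsplit, h0, zero_add]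
  exact (isPositive_pow' hT m).inner_nonneg_left _

end Positive

/-! ## Traces against the frame -/

section Trace

variable {E : Type*} [NormedAddCommGroup E] [InnerProductSpace ℝ E] {q : ℕ}
  {e : Fin (q + 1) → E} {θ : Fin (q + 1) → ℝ}

/-- `tr'` is additive. -/
theorem tr'_add (M M' : E →L[ℝ] E) : tr' (M + M') = tr' M + tr' M' := by
  simp [tr', map_add]

/-- `tr'` respects subtraction. -/
theorem tr'_sub (M M' : E →L[ℝ] E) : tr' (M - M') = tr' M - tr' M' := by
  simp [tr', map_sub]

/-- `tr'` is homogeneous. -/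
theorem tr'_smul (c : ℝ) (M : E →L[ℝ] E) : tr' (c • M) = c * tr' M := by
  simp [tr']

/-- `tr'` of a finite sum. -/
theorem tr'_sum {ι : Type*} (s : Finset ι) (f : ι → E →L[ℝ] E) :
    tr' (∑ i ∈ s, f i) = ∑ i ∈ s, tr' (f i) := by
  simp [tr', ContinuousLinearMap.toLinearMap_sum, map_sum]

/-- Cyclicity: `tr (M M') = tr (M' M)`. -/
theorem tr'_comm (M M' : E →L[ℝ] E) : tr' (M * M') = tr' (M' * M) := by
  unfold tr'
  rw [ContinuousLinearMap.toLinearMap_mul, LinearMap.trace_mul_comm, ← ContinuousLinearMap.toLinearMap_mul]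

variable [FiniteDimensional ℝ E]

/-- `tr (P_m M) = Σ_k θ_k^m ⟨e_k, M e_k⟩`. -/
theorem tr'_framePow_mul (θ : Fin (q + 1) → ℝ) (m : ℕ) (M : E →L[ℝ] E) :
    tr' (framePow e θ m * M) = ∑ k, θ k ^ m * ⟪e k, M (e k)⟫_ℝ := by
  unfold framePow
  rw [Finset.sum_mul, tr'_sum]
  refine Finset.sum_congr rfl fun k _ => ?_
  rw [smul_mul_assoc, tr'_smul, tr', trace_rankOne_mul_eq]

/-- `tr P_m = Σ_k θ_k^m` for an orthonormal frame. -/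
theorem tr'_framePow (hon : Orthonormal ℝ e) (θ : Fin (q + 1) → ℝ) (m : ℕ) :
    tr' (framePow e θ m) = ∑ k, θ k ^ m := by
  rw [← mul_one (framePow e θ m), tr'_framePow_mul]
  refine Finset.sum_congr rfl fun k _ => ?_
  rw [one_apply_eq_self, real_inner_self_eq_norm_sq, hon.1 k]; ring

/-- The `LL` double sum: `tr (P_a A P_b B) = Σ_k Σ_l θ_k^a θ_l^b ⟨e_k, A e_l⟩ ⟨e_l, B e_k⟩`. -/
theorem tr'_LL (θ : Fin (q + 1) → ℝ) (a b : ℕ) (A B : E →L[ℝ] E) :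
    tr' (framePow e θ a * A * framePow e θ b * B) =
      ∑ k, ∑ l, θ k ^ a * θ l ^ b * (⟪e k, A (e l)⟫_ℝ * ⟪e l, B (e k)⟫_ℝ) := by
  rw [mul_assoc, mul_assoc, tr'_framePow_mul]
  refine Finset.sum_congr rfl fun k _ => ?_
  rw [mul_apply_eq_comp, mul_apply_eq_comp, framePow_apply, map_sum, inner_sum, Finset.mul_sum]
  refine Finset.sum_congr rfl fun l _ => ?_
  rw [map_smul, real_inner_smul_right]; ring

end Trace

end Summit.QuantumFields.YangMills.Cruxes.IR.FluxCodeBlindness.CodeTrace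

end
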